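import Summits.HubbardSuperconductivity.HubbardSuperconductivity.Theorems.JosephsonMirrorWindowDouble

/-!
# Route `JosephsonMirror` — crux `JmCusp`, line `Sketch`: the abstract trial-pair gain bound

Helper file for crux item stmt-HubbardSuperconductivity-2228 (`JmCusp`) of route `JosephsonMirror`
(sub-problem `HubbardSuperconductivity`), stub `stub_gainAbstract` of line `Sketch`: the
generalisation of the abstract pair bridge `gain_le_minEnergyOn_sub`
(`Theorems/JosephsonMirrorWindowDouble`) from eigenvector pairs to ARBITRARY unit trial pairs.
For the window double `H(J) = A ⊗ 1 + 1 ⊗ Aᵀ - J (D ⊗ D̄ + Dᴴ ⊗ D̄ᴴ)` (`D̄ = (Dᴴ)ᵀ`,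
`D̄ᴴ = Dᵀ`) compressed to the window `S` of two-layer vectors supported on pairs lying in a
common block (`P₁` or `P₂`, disjoint, `A ≥ a` on the vectors supported in either block), and any
unit `u` supported in `P₁`, `w` supported in `P₂`, for `J ≥ 0`

  `J |⟨w, D u⟩|² - (Re⟨u, A u⟩ - a) - (Re⟨w, A w⟩ - a) ≤ E(0) - E(J)`,

`E(J) = minEnergyOn (H(J)) S`. Lower bound `E(0) ≥ 2a` column- and row-wise; upper bound by the
Rayleigh quotient of the trial state `(u ⊗ ū + w ⊗ w̄)/√2`, whose decoupled energy is
`Re⟨u, A u⟩ + Re⟨w, A w⟩` because `u ⊥ w` (disjoint supports), and whose Josephson coupling is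
`≥ 2 |⟨w, D u⟩|²`. The registered stub `stub_gainAbstract` (verbatim signature) is the final
declaration; the lead's de-doubling stub instantiates it on the Hubbard torus.
Sources: E. H. Lieb, Phys. Rev. Lett. 62 (1989) 1201, eq. (4) (the `W`-matrix packaging);
T. Koma, H. Tasaki, J. Stat. Phys. 76 (1994) 745 (LRO ⇒ SSB, trial states). No new definitions.
-/

-- the mandated namespace `Summit.<Summit>.<Problem>.Theorems` repeats `HubbardSuperconductivity`
-- (single-problem summit, D-0017), which the `dupNamespace` linter flags on every declaration
set_option linter.dupNamespace false
namespace Summit.HubbardSuperconductivity.HubbardSuperconductivity.Theorems.JosephsonMirror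

open Matrix Literature.MathematicalPhysics.QuantumLattice
open scoped Kronecker ComplexOrder

section Abstract

variable {ι : Type*} [Fintype ι] [DecidableEq ι]

/-- Matrix elements of the decoupled double `A ⊗ 1 + 1 ⊗ Aᵀ` between conjugate pure tensors:
`⟨x ⊗ x̄, (A ⊗ 1 + 1 ⊗ Aᵀ)(u ⊗ ū)⟩ = ⟨x, A u⟩ conj ⟨x, u⟩ + ⟨x, u⟩ conj ⟨x, A u⟩` for Hermitian
`A` (`(A ⊗ 1 + 1 ⊗ Aᵀ)(u ⊗ ū) = A u ⊗ ū + u ⊗ conj (A u)` since `Aᵀ ū = conj (Aᴴ u)`).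
Lieb, PRL 62 (1989) 1201, eq. (4). [folklore] -/
theorem star_tensor_conj_dotProduct_double_mulVec_tensor_conj {A : Matrix ι ι ℂ}
    (hA : A.IsHermitian) (x u : ι → ℂ) :
    star (fun p : ι × ι => x p.1 * (star x) p.2) ⬝ᵥ
        (A ⊗ₖ (1 : Matrix ι ι ℂ) + (1 : Matrix ι ι ℂ) ⊗ₖ Aᵀ) *ᵥ
          (fun p : ι × ι => u p.1 * (star u) p.2) =
      (star x ⬝ᵥ A *ᵥ u) * star (star x ⬝ᵥ u) + (star x ⬝ᵥ u) * star (star x ⬝ᵥ A *ᵥ u) := by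
  rw [add_mulVec, kronecker_mulVec_tensor, kronecker_mulVec_tensor, one_mulVec, one_mulVec,
    transpose_mulVec_star, hA.eq, dotProduct_add, star_tensor_dotProduct_tensor,
    star_tensor_dotProduct_tensor, star_star_dotProduct_star, star_star_dotProduct_star]

/-- **Abstract trial-pair bound for the Josephson gain of the window double.** Let `A` be
Hermitian, `D` arbitrary, and let the window `S` consist of the two-layer vectors supported on
pairs `(s, t)` lying in a common block (`P₁` or `P₂`, disjoint), where `A ≥ a` on the vectors
supported in either block. For ANY unit trial pair `u` (supported in `P₁`), `w` (supported in
`P₂`) and `J ≥ 0`, the lowest energy `E(J)` of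
`H(J) = A ⊗ 1 + 1 ⊗ Aᵀ - J (D ⊗ D̄ + Dᴴ ⊗ D̄ᴴ)` on `S` satisfies
`J |⟨w, D u⟩|² - (Re⟨u, A u⟩ - a) - (Re⟨w, A w⟩ - a) ≤ E(0) - E(J)`: the generalisation of
`gain_le_minEnergyOn_sub` from eigenvector pairs to trial pairs, paying the two excitation
energies. Lower bound `E(0) ≥ 2a` column- and row-wise; upper bound by the trial state
`(u ⊗ ū + w ⊗ w̄)/√2`, whose decoupled energy is `Re⟨u, A u⟩ + Re⟨w, A w⟩` (`u ⊥ w`) and whose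
coupling is `≥ 2 |⟨w, D u⟩|²`. Koma–Tasaki, J. Stat. Phys. 76 (1994) 745 (LRO ⇒ SSB);
Lieb, PRL 62 (1989) 1201 (the `W`-matrix packaging). [folklore] -/
theorem trialPair_gain_le_minEnergyOn_sub (A D : Matrix ι ι ℂ) (hA : A.IsHermitian)
    (P₁ P₂ : ι → Prop) (h12 : ∀ s, P₁ s → ¬ P₂ s)
    (good : ι × ι → Prop) (hgood : ∀ s t, good (s, t) → (P₁ s ∧ P₁ t) ∨ (P₂ s ∧ P₂ t))
    (hgood₁ : ∀ s t, P₁ s → P₁ t → good (s, t)) (hgood₂ : ∀ s t, P₂ s → P₂ t → good (s, t))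
    (S : Submodule ℂ (ι × ι → ℂ)) (hS : ∀ ψ, ψ ∈ S ↔ ∀ p, ¬ good p → ψ p = 0)
    (a : ℝ)
    (hA₁ : ∀ v : ι → ℂ, (∀ s, ¬ P₁ s → v s = 0) → a * (star v ⬝ᵥ v).re ≤ (star v ⬝ᵥ A *ᵥ v).re)
    (hA₂ : ∀ v : ι → ℂ, (∀ s, ¬ P₂ s → v s = 0) → a * (star v ⬝ᵥ v).re ≤ (star v ⬝ᵥ A *ᵥ v).re)
    (u w : ι → ℂ) (huP : ∀ s, ¬ P₁ s → u s = 0) (hwP : ∀ s, ¬ P₂ s → w s = 0)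
    (hu1 : star u ⬝ᵥ u = 1) (hw1 : star w ⬝ᵥ w = 1) {J : ℝ} (hJ : 0 ≤ J) :
    J * ‖star w ⬝ᵥ D *ᵥ u‖ ^ 2 - ((star u ⬝ᵥ A *ᵥ u).re - a) - ((star w ⬝ᵥ A *ᵥ w).re - a) ≤
      (A ⊗ₖ (1 : Matrix ι ι ℂ) + (1 : Matrix ι ι ℂ) ⊗ₖ Aᵀ -
          ((0 : ℝ) : ℂ) • (D ⊗ₖ Dᴴᵀ + Dᴴ ⊗ₖ Dᵀ)).minEnergyOn S -
        (A ⊗ₖ (1 : Matrix ι ι ℂ) + (1 : Matrix ι ι ℂ) ⊗ₖ Aᵀ -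
          (J : ℂ) • (D ⊗ₖ Dᴴᵀ + Dᴴ ⊗ₖ Dᵀ)).minEnergyOn S := by
  -- notation
  set H₀ : Matrix (ι × ι) (ι × ι) ℂ := A ⊗ₖ (1 : Matrix ι ι ℂ) + (1 : Matrix ι ι ℂ) ⊗ₖ Aᵀ with hH₀
  set K : Matrix (ι × ι) (ι × ι) ℂ := D ⊗ₖ Dᴴᵀ + Dᴴ ⊗ₖ Dᵀ with hK
  -- (1) block lower bound for vectors supported in one block
  have hblock : ∀ x : ι → ℂ, ((∀ t, ¬ P₁ t → x t = 0) ∨ (∀ t, ¬ P₂ t → x t = 0)) →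
      a * (star x ⬝ᵥ x).re ≤ (star x ⬝ᵥ A *ᵥ x).re := by
    intro x hx
    rcases hx with hx | hx
    · exact hA₁ x hx
    · exact hA₂ x hx
  -- supports of columns and rows of window vectors
  have hcol : ∀ ψ ∈ S, ∀ t, (∀ s, ¬ P₁ s → ψ (s, t) = 0) ∨ (∀ s, ¬ P₂ s → ψ (s, t) = 0) := by
    intro ψ hψ t
    have hz : ∀ s, ¬ good (s, t) → ψ (s, t) = 0 := fun s hs => (hS ψ).1 hψ (s, t) hs
    by_cases h1 : P₁ t
    · refine Or.inl fun s hs => hz s fun hg => ?_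
      rcases hgood s t hg with ⟨hs', -⟩ | ⟨-, ht'⟩
      · exact hs hs'
      · exact h12 t h1 ht'
    · by_cases h2 : P₂ t
      · refine Or.inr fun s hs => hz s fun hg => ?_
        rcases hgood s t hg with ⟨-, ht'⟩ | ⟨hs', -⟩
        · exact h1 ht'
        · exact hs hs'
      · refine Or.inl fun s _ => hz s fun hg => ?_
        rcases hgood s t hg with ⟨-, ht'⟩ | ⟨-, ht'⟩
        · exact h1 ht'
        · exact h2 ht'
  have hrow : ∀ ψ ∈ S, ∀ s, (∀ t, ¬ P₁ t → ψ (s, t) = 0) ∨ (∀ t, ¬ P₂ t → ψ (s, t) = 0) := by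
    intro ψ hψ s
    have hz : ∀ t, ¬ good (s, t) → ψ (s, t) = 0 := fun t ht => (hS ψ).1 hψ (s, t) ht
    by_cases h1 : P₁ s
    · refine Or.inl fun t ht => hz t fun hg => ?_
      rcases hgood s t hg with ⟨-, ht'⟩ | ⟨hs', -⟩
      · exact ht ht'
      · exact h12 s h1 hs'
    · by_cases h2 : P₂ s
      · refine Or.inr fun t ht => hz t fun hg => ?_
        rcases hgood s t hg with ⟨hs', -⟩ | ⟨-, ht'⟩
        · exact h1 hs'
        · exact ht ht'
      · refine Or.inl fun t _ => hz t fun hg => ?_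
        rcases hgood s t hg with ⟨hs', -⟩ | ⟨hs', -⟩
        · exact h1 hs'
        · exact h2 hs'
  -- (2) lower bound `2a ‖ψ‖² ≤ Re ⟨ψ, H₀ ψ⟩` on the window
  have hlow : ∀ ψ ∈ S, 2 * a * (star ψ ⬝ᵥ ψ).re ≤ (star ψ ⬝ᵥ H₀ *ᵥ ψ).re := by
    intro ψ hψ
    have hc : a * (star ψ ⬝ᵥ ψ).re ≤ (star ψ ⬝ᵥ (A ⊗ₖ (1 : Matrix ι ι ℂ)) *ᵥ ψ).re := by
      rw [star_dotProduct_kronecker_one_mulVec, star_dotProduct_self_eq_sum_cols, Complex.re_sum,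
        Complex.re_sum, Finset.mul_sum]
      exact Finset.sum_le_sum fun t _ => hblock _ (hcol ψ hψ t)
    have hr : a * (star ψ ⬝ᵥ ψ).re ≤ (star ψ ⬝ᵥ ((1 : Matrix ι ι ℂ) ⊗ₖ Aᵀ) *ᵥ ψ).re := by
      rw [star_dotProduct_one_kronecker_mulVec, star_dotProduct_self_eq_sum_rows, Complex.re_sum,
        Complex.re_sum, Finset.mul_sum]
      refine Finset.sum_le_sum fun s _ => ?_
      rw [star_dotProduct_transpose_mulVec, ← star_star_dotProduct_star_self]
      refine hblock (star fun t => ψ (s, t)) ?_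
      rcases hrow ψ hψ s with h | h
      · exact Or.inl fun t ht => by simp [h t ht]
      · exact Or.inr fun t ht => by simp [h t ht]
    rw [hH₀, add_mulVec, dotProduct_add, Complex.add_re]
    linarith
  -- (3) the trial vector `v = u ⊗ ū + w ⊗ w̄`
  set v : ι × ι → ℂ :=
    (fun p : ι × ι => u p.1 * (star u) p.2) + fun p : ι × ι => w p.1 * (star w) p.2 with hv
  have huw : star u ⬝ᵥ w = 0 := by
    rw [dotProduct]
    refine Finset.sum_eq_zero fun s _ => ?_
    by_cases h1 : P₁ s
    · rw [hwP s (h12 s h1), mul_zero]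
    · rw [Pi.star_apply, huP s h1, star_zero, zero_mul]
  have hwu : star w ⬝ᵥ u = 0 := by
    have := congrArg star huw
    rwa [star_dotProduct, star_star, star_zero] at this
  have hvv : star v ⬝ᵥ v = 2 := by
    rw [hv, star_add, add_dotProduct, dotProduct_add, dotProduct_add, star_tensor_conj_dotProduct,
      star_tensor_conj_dotProduct, star_tensor_conj_dotProduct, star_tensor_conj_dotProduct, hu1,
      hw1, huw, hwu]
    simp
    norm_num
  have hvS : v ∈ S := by
    refine (hS v).2 fun p hp => ?_
    obtain ⟨s, t⟩ := p
    have h1 : u s * (star u) t = 0 := by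
      by_cases hs : P₁ s
      · by_cases ht : P₁ t
        · exact absurd (hgood₁ s t hs ht) hp
        · rw [Pi.star_apply, huP t ht, star_zero, mul_zero]
      · rw [huP s hs, zero_mul]
    have h2 : w s * (star w) t = 0 := by
      by_cases hs : P₂ s
      · by_cases ht : P₂ t
        · exact absurd (hgood₂ s t hs ht) hp
        · rw [Pi.star_apply, hwP t ht, star_zero, mul_zero]
      · rw [hwP s hs, zero_mul]
    simp only [hv, Pi.add_apply, h1, h2, add_zero]
  -- the decoupled energy of the trial vector: cross terms vanish since `u ⊥ w`
  have hH₀v : (star v ⬝ᵥ H₀ *ᵥ v).re =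
      2 * (star u ⬝ᵥ A *ᵥ u).re + 2 * (star w ⬝ᵥ A *ᵥ w).re := by
    rw [hH₀, hv, mulVec_add, star_add, add_dotProduct, dotProduct_add, dotProduct_add,
      star_tensor_conj_dotProduct_double_mulVec_tensor_conj hA,
      star_tensor_conj_dotProduct_double_mulVec_tensor_conj hA,
      star_tensor_conj_dotProduct_double_mulVec_tensor_conj hA,
      star_tensor_conj_dotProduct_double_mulVec_tensor_conj hA, hu1, hw1, huw, hwu]
    simp only [star_zero, star_one, mul_zero, zero_mul, add_zero, mul_one, one_mul,
      Complex.add_re, Complex.zero_re, Complex.star_def, Complex.conj_re]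
    ring
  -- the Josephson coupling of the trial vector
  have hKv : 2 * ‖star w ⬝ᵥ D *ᵥ u‖ ^ 2 ≤ (star v ⬝ᵥ K *ᵥ v).re := by
    have h1 := normSq_le_re_coupling_trial D u w
    have h2 := normSq_le_re_coupling_trial Dᴴ w u
    rw [conjTranspose_conjTranspose, norm_star_dotProduct_conjTranspose_mulVec] at h2
    have h2' : ‖star w ⬝ᵥ D *ᵥ u‖ ^ 2 ≤ (star v ⬝ᵥ (Dᴴ ⊗ₖ Dᵀ) *ᵥ v).re := by
      rw [hv, add_comm]
      exact h2
    rw [hK, add_mulVec, dotProduct_add, Complex.add_re]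
    rw [hv] at h2' ⊢
    rw [← hv] at h2' ⊢
    linarith [h1]
  -- (4) the normalised trial state `Ψ = v / √2`
  set c : ℂ := (((Real.sqrt 2)⁻¹ : ℝ) : ℂ) with hc
  have hcc : star c * c = (1 / 2 : ℝ) := by
    rw [hc, Complex.star_def, Complex.conj_ofReal, ← Complex.ofReal_mul]
    congr 1
    rw [← mul_inv, Real.mul_self_sqrt (by norm_num : (0 : ℝ) ≤ 2)]
    norm_num
  set Ψ : ι × ι → ℂ := c • v with hΨ
  have hΨS : Ψ ∈ S := S.smul_mem c hvS
  have hΨM : ∀ M : Matrix (ι × ι) (ι × ι) ℂ,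
      star Ψ ⬝ᵥ M *ᵥ Ψ = ((1 / 2 : ℝ) : ℂ) * (star v ⬝ᵥ M *ᵥ v) := by
    intro M
    rw [hΨ, mulVec_smul, star_smul, smul_dotProduct, dotProduct_smul, smul_smul, hcc, smul_eq_mul]
  have hΨ1 : star Ψ ⬝ᵥ Ψ = 1 := by
    have h := hΨM 1
    rw [one_mulVec, one_mulVec, hvv] at h
    rw [h]
    push_cast
    ring
  -- (5) upper bound on `E(J)` by the trial state
  have hHerm := isHermitian_windowDouble hA D J
  have hup : (H₀ - (J : ℂ) • K).minEnergyOn S ≤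
      (star u ⬝ᵥ A *ᵥ u).re + (star w ⬝ᵥ A *ᵥ w).re - J * ‖star w ⬝ᵥ D *ᵥ u‖ ^ 2 := by
    refine (minEnergyOn_le_rayleigh_of_mem hHerm S hΨS hΨ1).trans ?_
    rw [sub_mulVec, dotProduct_sub, Complex.sub_re, hΨM, hΨM, smul_mulVec, dotProduct_smul,
      smul_eq_mul, Complex.re_ofReal_mul, Complex.re_ofReal_mul, Complex.re_ofReal_mul, hH₀v]
    nlinarith [hKv, hJ]
  -- (6) lower bound on `E(0)`
  have hlow0 : 2 * a ≤ (H₀ - ((0 : ℝ) : ℂ) • K).minEnergyOn S := by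
    rw [Complex.ofReal_zero, zero_smul, sub_zero]
    refine le_csInf ⟨(star Ψ ⬝ᵥ H₀ *ᵥ Ψ).re, Ψ, hΨS, hΨ1, rfl⟩ ?_
    rintro E ⟨ψ, hψS, hψ1, rfl⟩
    have h := hlow ψ hψS
    rw [hψ1, Complex.one_re, mul_one] at h
    exact h
  linarith

end Abstract

/-- **Registered stub `stub_gainAbstract` of line `Sketch` (crux `JmCusp`,
stmt-HubbardSuperconductivity-2228), verbatim signature**, closed by
`trialPair_gain_le_minEnergyOn_sub`: the abstract trial-pair bound
`J |⟨w, D u⟩|² - (Re⟨u, A u⟩ - a) - (Re⟨w, A w⟩ - a) ≤ E(0) - E(J)` for the window double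
`A ⊗ 1 + 1 ⊗ Aᵀ - J (D ⊗ D̄ + Dᴴ ⊗ D̄ᴴ)` compressed to the window `S`.
Koma–Tasaki, J. Stat. Phys. 76 (1994) 745; Lieb, PRL 62 (1989) 1201. [folklore] -/
theorem stub_gainAbstract {ι : Type} [Fintype ι] [DecidableEq ι]
    (A D : Matrix ι ι ℂ) (hA : A.IsHermitian)
    (P₁ P₂ : ι → Prop) (h12 : ∀ s, P₁ s → ¬ P₂ s)
    (good : ι × ι → Prop) (hgood : ∀ s t, good (s, t) → (P₁ s ∧ P₁ t) ∨ (P₂ s ∧ P₂ t))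
    (hgood₁ : ∀ s t, P₁ s → P₁ t → good (s, t)) (hgood₂ : ∀ s t, P₂ s → P₂ t → good (s, t))
    (S : Submodule ℂ (ι × ι → ℂ)) (hS : ∀ ψ, ψ ∈ S ↔ ∀ p, ¬ good p → ψ p = 0)
    (a : ℝ)
    (hA₁ : ∀ v : ι → ℂ, (∀ s, ¬ P₁ s → v s = 0) → a * (star v ⬝ᵥ v).re ≤ (star v ⬝ᵥ A.mulVec v).re)
    (hA₂ : ∀ v : ι → ℂ, (∀ s, ¬ P₂ s → v s = 0) → a * (star v ⬝ᵥ v).re ≤ (star v ⬝ᵥ A.mulVec v).re)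
    (u w : ι → ℂ) (huP : ∀ s, ¬ P₁ s → u s = 0) (hwP : ∀ s, ¬ P₂ s → w s = 0)
    (hu1 : star u ⬝ᵥ u = 1) (hw1 : star w ⬝ᵥ w = 1) {J : ℝ} (hJ : 0 ≤ J) :
    J * ‖star w ⬝ᵥ D.mulVec u‖ ^ 2 - ((star u ⬝ᵥ A.mulVec u).re - a) - ((star w ⬝ᵥ A.mulVec w).re - a) ≤
      (Matrix.kroneckerMap (fun a b : ℂ => a * b) A 1 + Matrix.kroneckerMap (fun a b : ℂ => a * b) 1 Aᵀ -
          ((0 : ℝ) : ℂ) • (Matrix.kroneckerMap (fun a b : ℂ => a * b) D Dᴴᵀ +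
            Matrix.kroneckerMap (fun a b : ℂ => a * b) Dᴴ Dᵀ)).minEnergyOn S -
        (Matrix.kroneckerMap (fun a b : ℂ => a * b) A 1 + Matrix.kroneckerMap (fun a b : ℂ => a * b) 1 Aᵀ -
          (J : ℂ) • (Matrix.kroneckerMap (fun a b : ℂ => a * b) D Dᴴᵀ +
            Matrix.kroneckerMap (fun a b : ℂ => a * b) Dᴴ Dᵀ)).minEnergyOn S :=
  trialPair_gain_le_minEnergyOn_sub A D hA P₁ P₂ h12 good hgood hgood₁ hgood₂ S hS a hA₁ hA₂ u w huP
    hwP hu1 hw1 hJ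

end Summit.HubbardSuperconductivity.HubbardSuperconductivity.Theorems.JosephsonMirror
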